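import Mathlib
import Literature.Computability.Cryptography.QuantumQuery
import Literature.Computability.QuantumComplexity.SinkOfVerifiableLine
import Literature.Computability.QuantumComplexity.SpectralAdversary
import Summits.QuantumAdvantage.QuantumAdvantage.Theses.WhiteBoxWalk

/-!
# Sketch — crux-ideate stmt-QuantumAdvantage-2239 (WbwVerifiableLineNoSpeedup), ideator 3

First-lemma signatures of the two idea cards (statements only; nothing here is proved):

* card `swap-relational-adversary`: `RelationalAdversaryBound` (Ambainis' weighted / Aaronson's
  relational adversary theorem for the tree's model `QQueryAlg` on a promise set) and the
  permutation sub-family `svlPermInput` / `svlPermPromise` on which the swap relation lives, with the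
  target of the line `SwapAdversaryTarget` (no `1/m` loss) and its corollary shape `crux_of_target`.
* card `recorded-frontier`: `coreAvg` (average-case advantage over uniformly random successor
  tables with the verifier FORCED to be the orbit indicator) and `RecordedFrontierCore`,
  `worstCase_of_coreAvg` (the transfer back to the worst-case promise problem).
-/

open scoped BigOperators
open Literature.Computability.Cryptography Literature.Computability.QuantumComplexity

namespace Summit.QuantumAdvantage.QuantumAdvantage.Cruxes.WbwVerifiableLineNoSpeedup.Sketch

/-! ## Card 1 — swap-relational-adversary -/

/-- `θ_R(x,i)`: the `R`-weight fraction of the relatives `y` of `x` that differ from `x` at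
position `i` (Aaronson 2006 §3; Ambainis 2006 Thm 5 with `w' := w`). -/
noncomputable def theta {N : ℕ} (R : (Fin N → Bool) → (Fin N → Bool) → ℝ)
    (x : Fin N → Bool) (i : Fin N) : ℝ :=
  (∑ y : Fin N → Bool, if x i = y i then 0 else R x y) / ∑ y : Fin N → Bool, R x y

/-- FIRST LEMMA (card 1). The relational (= weighted, `w' = w`) adversary bound for `QQueryAlg` on a
promise set `D`: if `R ≥ 0` is symmetric, supported on pairs in `D × D` with `f x ≠ f y`, not
identically zero, and `θ_R(x,i) · θ_R(y,i) ≤ υ²` whenever `R x y ≠ 0` and `x i ≠ y i`, then every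
algorithm computing `f` on `D` with error `1/3` makes at least `1/(C υ)` queries (printed:
`Ω(1/υ_geom)`, Aaronson SICOMP 35 (2006) Thm 4 = Ambainis JCSS 72 (2006) Thm 5; the constant `C`
absorbs `(1 - 2√(ε(1-ε)))⁻¹`). Proof = the progress-function argument already in
`SpectralAdversary.lean` (`rinner`, `progress`, `rinner_mulVec_of_mem_unitaryGroup`,
`foldl_invariant`) with pairs differing in MANY positions (`QueryHybridBound.sum_norm_sq_oracle_sub_le`
replaces the single-bit `rinner_sub_rinner_oracle`). -/
def RelationalAdversaryBound : Prop :=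
  ∃ C : ℝ, 0 < C ∧ ∀ (N : ℕ) (A : QQueryAlg N) (D : Set (Fin N → Bool)) (f : (Fin N → Bool) → Bool),
    A.ComputesWithError (1 / 3) D f →
    ∀ (R : (Fin N → Bool) → (Fin N → Bool) → ℝ) (υ : ℝ), 0 < υ →
      (∀ x y, 0 ≤ R x y) → (∀ x y, R x y = R y x) →
      (∀ x y, R x y ≠ 0 → x ∈ D ∧ y ∈ D ∧ f x ≠ f y) →
      (∃ x y, R x y ≠ 0) →
      (∀ x y i, R x y ≠ 0 → x i ≠ y i → theta R x i * theta R y i ≤ υ ^ 2) →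
      1 / υ ≤ C * A.queries

/-- The PERMUTATION sub-family: successor table `S := π` (a permutation of the names), verifier
`V(x,i) := [x = πⁱ(0)]` (the orbit indicator). -/
noncomputable def svlPermInput (m T : ℕ) (π : Equiv.Perm (Fin (2 ^ m))) : SVLInput m T :=
  svlInput m T π fun x i => decide (x = (π ^ (i : ℕ)) 0)

/-- The permutation instances inside the promise: the `0`-orbit `0, π 0, …, π^T 0` is simple
(equivalently: the `π`-cycle of `0` is longer than `T`). -/
def svlPermPromise (m T : ℕ) : Set (SVLInput m T) :=
  {t | ∃ π : Equiv.Perm (Fin (2 ^ m)),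
    Function.Injective (fun i : Fin (T + 1) => (π ^ (i : ℕ)) 0) ∧ t = svlPermInput m T π}

/-- Sanity shape (to be proved in the line, routine): permutation instances with a simple orbit
satisfy the promise, so `Q(svlPermPromise) ≤ Q(svlPromise)` by `quantumQueryComplexityOn_anti`. -/
def svlPermPromise_subset : Prop :=
  ∀ m T : ℕ, svlPermPromise m T ⊆ svlPromise m T

/-- TARGET of the line (card 1), stronger than the crux (no `1/m`): on the permutation sub-family
already, `Q_{1/3} ≥ c · min(T+1, √(2ᵐ))`. The swap relation: `x ~ y` iff `π_y = π_x ∘ (b  x_k)`-type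
two-point target swap (`π_y(x_k) = π_x(b)`, `π_y(b) = π_x(x_k) = x_{k+1}`), with `υ = O(max(1/T, 1/√(2ᵐ)))`. -/
def SwapAdversaryTarget : Prop :=
  ∃ c : ℝ, 0 < c ∧ ∀ m T : ℕ, 2 ≤ m → 1 ≤ T → T + 1 ≤ 2 ^ (m - 1) →
    c * min ((T : ℝ) + 1) (Real.sqrt (2 ^ m)) ≤
      (quantumQueryComplexityOn (1 / 3) (svlPermPromise m T) (svlSinkBit m T) : ℝ)

/-- Assembly shape of the line: target ⟹ crux (monotonicity in the promise set and `1 ≤ m`). -/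
def crux_of_target : Prop :=
  svlPermPromise_subset → (∀ N : ℕ, quantumQueryComplexityOn_anti (N := N)) →
    SwapAdversaryTarget →
      Summit.QuantumAdvantage.QuantumAdvantage.Theses.WhiteBoxWalk.WbwVerifiableLineNoSpeedup

/-! ## Card 2 — recorded-frontier -/

/-- The instance generated by an ARBITRARY successor table `S` with the verifier forced to be the
indicator of the `S`-orbit of `0` (in the promise iff that orbit is simple for `T` steps). -/
noncomputable def svlOrbitInput (m T : ℕ) (S : Fin (2 ^ m) → Fin (2 ^ m)) : SVLInput m T :=
  svlInput m T S fun x i => decide (x = S^[(i : ℕ)] 0)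

/-- Average-case advantage of `A` over a UNIFORMLY RANDOM successor table (a random function, the
compressed-oracle regime), counting off-promise tables (orbit of `0` not simple) as failures. -/
noncomputable def coreAvg (m T : ℕ) (A : QQueryAlg (2 ^ m * m + 2 ^ m * (T + 1))) : ℝ :=
  (Fintype.card (Fin (2 ^ m) → Fin (2 ^ m)) : ℝ)⁻¹ *
    ∑ S : Fin (2 ^ m) → Fin (2 ^ m),
      if Function.Injective (fun i : Fin (T + 1) => S^[(i : ℕ)] 0) then
        (if svlSinkBit m T (svlOrbitInput m T S) = true then A.acceptProb (svlOrbitInput m T S)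
          else 1 - A.acceptProb (svlOrbitInput m T S))
      else 0

/-- FIRST LEMMA (card 2), the recorded-frontier core in the birthday regime `64 T² ≤ 2ᵐ`:
`q ≤ c · T` queries give average success `≤ 3/5` (the chain-extension capacity of
Chung–Fehr–Huang–Liao EUROCRYPT 2021 §2 "Finding a chain", with the verifier answered from the
recorded database; HONEST REACH of the printed calculus: `c · min(T, 2^{m/3})`, typed here in the
regime where that equals `c · T`). -/
def RecordedFrontierCore : Prop :=
  ∃ c : ℝ, 0 < c ∧ ∀ m T : ℕ, 2 ≤ m → 1 ≤ T → 64 * T ^ 3 ≤ 2 ^ m →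
    ∀ A : QQueryAlg (2 ^ m * m + 2 ^ m * (T + 1)), (A.queries : ℝ) ≤ c * T →
      coreAvg m T A ≤ 3 / 5

/-- TRANSFER (card 2): worst-case correctness on the promise forces average success
`≥ (2/3) · P[orbit simple] ≥ (2/3)(1 - (T+1)²/2^{m+1}) > 3/5` in the birthday regime, so the core
bounds `quantumQueryComplexityOn` from below (uses `exists_queries_eq_quantumQueryComplexityOn`). -/
def worstCase_of_coreAvg : Prop :=
  ∀ m T : ℕ, 2 ≤ m → 64 * T ^ 2 ≤ 2 ^ m →
    ∀ A : QQueryAlg (2 ^ m * m + 2 ^ m * (T + 1)),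
      A.ComputesWithError (1 / 3) (svlPromise m T) (svlSinkBit m T) → 3 / 5 < coreAvg m T A

end Summit.QuantumAdvantage.QuantumAdvantage.Cruxes.WbwVerifiableLineNoSpeedup.Sketch
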